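import Mathlib
import Summits.HodgeConjecture.HodgeConjecture.Theorems.HodgeLocusCensusUnitColumnRankLevelsChar

/-!
# HodgeLocus census — THE FIRST EXCEPTION OF EVERY PRIME (unit column, `d = 3`, level `1`; ENGINE B gen 54, PROBE 13)

certified instances and evidence bearing on the general Hodge conjecture; no claim.

SETTING.  Anchors 229/230 (`…UnitColumnRankLevelsPowers`, `…UnitColumnRankLevelsChar`) reduce the rank of the multiplicity matrix of `×q^c` between the level
pieces of the bounded-exponent model `B = K[x₁,…,x_k]/(xᵢ^{e+2})` (`q = Σ xᵢ^{e+1}`; unit column of the degree-`d = e + 3` Fermat) to the label-block sum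
`Σ_μ rank (c! • W_{t,t+c}(k − s))` over ANY field (230's `rank_mulDeltaPow_levels_eq_sum`), and anchors 231/246 evaluate the inclusion-matrix ranks in
characteristic `0` or `p > n` (Gottlieb–Kantor), where THEOREM L holds verbatim.  In characteristic `p ≤ k` the blocks `W_{t,t+c}(n)` may drop rank (Wilson,
Europ. J. Combin. 11 (1990) 609–615; short proof arXiv:2009.05202); the positive-characteristic exceptions table was generated from (LW) + Wilson's formula and
certified numerically in gen 53 (`gen53/check/EXCEPTIONS-TABLE-g53.md`), but no rank drop for a prime `p ≥ 5` is a kernel theorem yet ((L2)/(W2) of anchor 230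
are `p = 2`; (N1)–(N5) of `…UnitColumnRankD3Deficit` are `p = 2, 3`).

THEOREMS (kernel statements; `K` a field, `α` a finite type with decidable equality).
 POINT RULE for `W_{1,1+c}(α)` = the `{1-sets} × {(1+c)-sets}` inclusion matrix (typed as anchor 230's blocks: rows `{S // S.card = t}`, columns
 `{S // S.card = t + c}`, hypothesis `t = 1`), `c + 2 ≤ |α|`:
 (P0) `rank_incl_point_of_cast_eq_zero` — `((t + c : ℕ) : K) = 0` ⇒ `rank = |α| − 1`;
 (P1) `rank_incl_point_of_cast_ne_zero` — `((t + c : ℕ) : K) ≠ 0` ⇒ `rank = |α|`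
 (the `t = 1` row of Wilson's `p`-rank theorem, over every field; pieces `sum_incl_point_col`, `exists_notMem_notMem_card_eq`, `ite_singleton_subset_insert`,
 `single_sub_single_mem_span_incl_point`, `card_le_rank_incl_point_add_one`, `rank_incl_le_choose`).
 CENSUS at `d = 3` (`e = 0`), level `j = 1`, i.e. `×q^c : B_{k−1−c} → B_{k−1}` on `B = K[x₁,…,x_k]/(xᵢ²)` — anchor 229's matrix at `e = 0, j = 1` with the index
 arithmetic normalised (`Fin 2`, codegrees `1` and `1 + c` out of `k`, `colR 3`); `rank_d3_one_eq` is the `rfl` reindexing (`Matrix.rank_reindex`,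
 `Equiv.subtypeEquivRight`) to the LITERAL instance `e := 0, j := 1` of anchors 229/230 — with `c + 2 ≤ k` and `c!` a unit of `K`:
 (E0) `rank_mulDeltaPow_d3_one_of_cast_eq_zero` — `((1 + c : ℕ) : K) = 0` ⇒ `rank = k − 1`;
 (E1) `rank_mulDeltaPow_d3_one_of_cast_ne_zero` — `((1 + c : ℕ) : K) ≠ 0` ⇒ `rank = k` (= THEOREM L's value `min (C(k,1), C(k,1+c))`, anchor 229);
 (EP) `rank_mulDeltaPow_d3_one_charP` — `CharP K p`, `p` prime, `p + 1 ≤ k`, `c = p − 1` ⇒ `rank = k − 1`: THE FIRST EXCEPTION OF EVERY PRIME.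
 At `p = 2` (EP) agrees with the `e = 0, j = 1` instance of anchor 230's (L2) (value `C(k−1,1)`), at `p = 3` with (N3) of `…UnitColumnRankD3Deficit`
 (`k ≥ 4`, rank `k − 1`); for `p ≥ 5` it is new.  In the (LW)+Wilson table the cell `(d = 3, k = p + 1, c = p − 1, j = 1)` is an exception of `p` with the
 fewest variables (no block `W_{t,t+c}(n)` with `n ≤ p` drops rank) — a fact of that table, not a Lean statement here.

METHOD (minor-free, no `decide`; the generic rank lemmas of `…UnitColumnRankD3Deficit` BY NAME).  UPPER in (P0): the all-ones row vector lies in the left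
kernel, since every column of `W_{1,1+c}` sums to `1 + c` (`sum_incl_point_col` = anchor 230's `sum_ite_subset_subset` at `S = ∅`;
`rank_add_one_le_card_of_vecMul_eq_zero`); UPPER in (P1): the row count (`Matrix.rank_le_card_height`).  LOWER (both): for points `x, y` and a `c`-set
`B ∌ x, y` (`exists_notMem_notMem_card_eq`; this is where `c + 2 ≤ |α|` is used), `col (B ∪ {x}) − col (B ∪ {y}) = e_x − e_y` (`ite_singleton_subset_insert`),
so every difference of unit vectors lies in the column span (`single_sub_single_mem_span_incl_point`; `card_le_rank_add_one_of_sub_mem`); in (P1) moreover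
`(1 + c) • e_x = col (B ∪ {x}) − Σ_{z ∈ B} (e_z − e_x)` with `1 + c` a unit (`card_le_rank_add_card_of_single_mem_sup` with the empty hub).  CENSUS: anchor 230's
`rank_mulDeltaPow_levels_eq_sum K k 0 c 1` has the single label `μ = 0` (`label_d3`: `t = 1`, all `k` points label-zero, the feasibility condition holds), the
block is `c! • W_{1,1+c}` (`rank_smul_of_ne_zero` of `…UnitColumnRankD3LevelsPowers`), then (P0)/(P1); (EP): `(p − 1)!` is a unit (`Nat.Prime.dvd_factorial`,
`CharP.cast_eq_zero_iff`) and `((1 + (p − 1) : ℕ) : K) = (p : K) = 0` (`CharP.cast_eq_zero`).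
SCOPE (said plainly).  Exact ranks of explicit matrices; that they are the census quantities of THEOREM L / THEOREM K-MODEL is the record's step (outside Lean,
as in the anchors).  Evidence-class content: kernel theorems in place of numerics for one infinite family of cells per prime (`d = 3`, `j = 1`, `c = p − 1`, all
`k ≥ p + 1`); no census number changes; nothing about HC.  Second implementation: `check_firstexception.py` (ranks over `GF(p)`, `p ≤ 13`, and over `ℚ` of
`W_{1,1+c}(n)`, `n ≤ 10`, and of the literal multiplicity matrices of the (E·) statements, `k ≤ 9`, built from the statement text: `colR 3` iterated on exponent
lists, `List.count`).
-/

set_option linter.dupNamespace false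
set_option autoImplicit false

namespace Summit.HodgeConjecture.HodgeConjecture.HodgeLocus.Census.UnitColumnRankFirstException

open Summit.HodgeConjecture.HodgeConjecture.HodgeLocus.Census.ModelNonJumpC1All (colR)
open Summit.HodgeConjecture.HodgeConjecture.HodgeLocus.Census.UnitColumnRankLevelsChar (sum_ite_subset_subset
  rank_mulDeltaPow_levels_eq_sum)
open Summit.HodgeConjecture.HodgeConjecture.HodgeLocus.Census.UnitColumnRankD3LevelsPowers (rank_smul_of_ne_zero)
open Summit.HodgeConjecture.HodgeConjecture.HodgeLocus.Census.UnitColumnRankD3Deficit (rank_add_one_le_card_of_vecMul_eq_zero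
  card_le_rank_add_one_of_sub_mem card_le_rank_add_card_of_single_mem_sup)
open Matrix Module

/-! ## The point rule: `W_{1,1+c}(α)` over an arbitrary field -/

section Incl

variable (K : Type*) [Field K] {α : Type*} [Fintype α] [DecidableEq α]

/-- COLUMN SUMS: a `(t + c)`-set has `t + c` points (`t = 1`; anchor 230's `sum_ite_subset_subset` at `S = ∅`). -/
theorem sum_incl_point_col (t c : ℕ) (ht : t = 1) (U : {S : Finset α // S.card = t + c}) :
    (∑ T : {S : Finset α // S.card = t}, (if T.1 ⊆ U.1 then (1 : K) else 0)) = ((t + c : ℕ) : K) := by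
  subst ht
  have h := sum_ite_subset_subset K (∅ : Finset α) U.1 0 Finset.card_empty
  simp only [Finset.empty_subset, true_and, Finset.sdiff_empty] at h
  rw [U.2] at h
  exact h

/-- a `c`-set avoiding two (possibly equal) points exists as soon as `c + 2 ≤ |α|` -/
theorem exists_notMem_notMem_card_eq (x y : α) (c : ℕ) (hc : c + 2 ≤ Fintype.card α) :
    ∃ B : Finset α, x ∉ B ∧ y ∉ B ∧ B.card = c := by
  obtain ⟨B, hBsub, hBc⟩ := Finset.exists_subset_card_eq (s := ({x, y} : Finset α)ᶜ) (n := c)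
    (by rw [Finset.card_compl]; have := Finset.card_le_two (a := x) (b := y); omega)
  refine ⟨B, fun h => ?_, fun h => ?_, hBc⟩
  · have h' := Finset.mem_compl.mp (hBsub h); simp at h'
  · have h' := Finset.mem_compl.mp (hBsub h); simp at h'

omit [Fintype α] in
/-- THE COLUMN OF `insert x B` (`x ∉ B`) read at the point rows: `[z ∈ insert x B] = [z = x] + [z ∈ B]`. -/
theorem ite_singleton_subset_insert (x : α) (B : Finset α) (hxB : x ∉ B) (T : {S : Finset α // S.card = 1}) :
    (if T.1 ⊆ insert x B then (1 : K) else 0) =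
      (if T = ⟨{x}, Finset.card_singleton x⟩ then (1 : K) else 0) + (if T.1 ⊆ B then 1 else 0) := by
  obtain ⟨z, hz⟩ := Finset.card_eq_one.mp T.2
  have hT : T = ⟨{z}, Finset.card_singleton z⟩ := Subtype.ext hz
  rw [hT]
  simp only [Finset.singleton_subset_iff, Finset.mem_insert, Subtype.mk.injEq, Finset.singleton_inj]
  by_cases hzx : z = x
  · subst hzx
    rw [if_pos (Or.inl rfl), if_pos rfl, if_neg hxB, add_zero]
  · rw [if_neg hzx, zero_add]
    exact if_congr (or_iff_right hzx) rfl rfl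

/-- DIFFERENCES OF UNIT ROW VECTORS lie in the column span of `W_{1,1+c}(α)` (`c + 2 ≤ |α|`): `e_{{x}} − e_{{y}} = col (B ∪ {x}) − col (B ∪ {y})`
for a `c`-set `B` avoiding `x, y`. -/
theorem single_sub_single_mem_span_incl_point (t c : ℕ) (ht : t = 1) (hc : c + 2 ≤ Fintype.card α)
    (s s' : {S : Finset α // S.card = t}) :
    (Pi.single s (1 : K) : {S : Finset α // S.card = t} → K) - Pi.single s' 1 ∈ Submodule.span K (Set.range
      (Matrix.of fun (T : {S : Finset α // S.card = t}) (U : {S : Finset α // S.card = t + c}) => if T.1 ⊆ U.1 then (1 : K) else 0).col) := by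
  subst ht
  obtain ⟨x, hx⟩ := Finset.card_eq_one.mp s.2
  obtain ⟨y, hy⟩ := Finset.card_eq_one.mp s'.2
  have hs : s = ⟨{x}, Finset.card_singleton x⟩ := Subtype.ext hx
  have hs' : s' = ⟨{y}, Finset.card_singleton y⟩ := Subtype.ext hy
  obtain ⟨B, hxB, hyB, hBc⟩ := exists_notMem_notMem_card_eq x y c hc
  have hdiff : (Matrix.of fun (T : {S : Finset α // S.card = 1}) (U : {S : Finset α // S.card = 1 + c}) => if T.1 ⊆ U.1 then (1 : K) else 0).col
        ⟨insert x B, by rw [Finset.card_insert_of_notMem hxB, hBc, add_comm]⟩ -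
      (Matrix.of fun (T : {S : Finset α // S.card = 1}) (U : {S : Finset α // S.card = 1 + c}) => if T.1 ⊆ U.1 then (1 : K) else 0).col
        ⟨insert y B, by rw [Finset.card_insert_of_notMem hyB, hBc, add_comm]⟩ = Pi.single s (1 : K) - Pi.single s' 1 := by
    funext T
    rw [Pi.sub_apply, Pi.sub_apply, Matrix.col_apply, Matrix.col_apply, Matrix.of_apply, Matrix.of_apply,
      ite_singleton_subset_insert K x B hxB T, ite_singleton_subset_insert K y B hyB T, hs, hs', Pi.single_apply, Pi.single_apply]
    ring
  rw [← hdiff]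
  exact Submodule.sub_mem _ (Submodule.subset_span ⟨_, rfl⟩) (Submodule.subset_span ⟨_, rfl⟩)

/-- LOWER BOUND over any field: `|α| ≤ rank W_{1,1+c}(α) + 1` (`c + 2 ≤ |α|`). -/
theorem card_le_rank_incl_point_add_one (t c : ℕ) (ht : t = 1) (hc : c + 2 ≤ Fintype.card α) :
    Fintype.card α ≤ (Matrix.of fun (T : {S : Finset α // S.card = t}) (U : {S : Finset α // S.card = t + c}) =>
      if T.1 ⊆ U.1 then (1 : K) else 0).rank + 1 := by
  have hsub := single_sub_single_mem_span_incl_point K t c ht hc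
  subst ht
  have h := card_le_rank_add_one_of_sub_mem (m := {S : Finset α // S.card = 1}) (n := {S : Finset α // S.card = 1 + c}) _ hsub
  rwa [Fintype.card_finset_len, Nat.choose_one_right] at h

/-- UPPER BOUND over any field: `rank W_{t,t+c}(α) ≤ C(|α|, t)` (row count). -/
theorem rank_incl_le_choose (t c : ℕ) :
    (Matrix.of fun (T : {S : Finset α // S.card = t}) (U : {S : Finset α // S.card = t + c}) =>
      if T.1 ⊆ U.1 then (1 : K) else 0).rank ≤ (Fintype.card α).choose t := by
  have h := Matrix.rank_le_card_height (Matrix.of fun (T : {S : Finset α // S.card = t}) (U : {S : Finset α // S.card = t + c}) =>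
      if T.1 ⊆ U.1 then (1 : K) else 0)
  rwa [Fintype.card_finset_len] at h

/-- THE POINT RULE, DEFICIENT CASE: if `1 + c = 0` in `K` (and `c + 2 ≤ |α|`) then `rank W_{1,1+c}(α) = |α| − 1`
(the all-ones row vector is in the left kernel: every column sums to `1 + c`). -/
theorem rank_incl_point_of_cast_eq_zero (t c : ℕ) (ht : t = 1) (hc : c + 2 ≤ Fintype.card α) (h0 : ((t + c : ℕ) : K) = 0) :
    (Matrix.of fun (T : {S : Finset α // S.card = t}) (U : {S : Finset α // S.card = t + c}) => if T.1 ⊆ U.1 then (1 : K) else 0).rank =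
      Fintype.card α - 1 := by
  have hlow := card_le_rank_incl_point_add_one K t c ht hc
  have hsum := sum_incl_point_col K (α := α) t c ht
  subst ht
  obtain ⟨x₀⟩ : Nonempty α := Fintype.card_pos_iff.mp (by omega)
  have hup : (Matrix.of fun (T : {S : Finset α // S.card = 1}) (U : {S : Finset α // S.card = 1 + c}) =>
      if T.1 ⊆ U.1 then (1 : K) else 0).rank + 1 ≤ Fintype.card α := by
    have h := rank_add_one_le_card_of_vecMul_eq_zero (Matrix.of fun (T : {S : Finset α // S.card = 1}) (U : {S : Finset α // S.card = 1 + c}) =>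
      if T.1 ⊆ U.1 then (1 : K) else 0) (fun _ => 1)
        (Function.ne_iff.mpr ⟨⟨{x₀}, Finset.card_singleton x₀⟩, one_ne_zero⟩) (funext fun U => by
          show (∑ T : {S : Finset α // S.card = 1}, (1 : K) * (if T.1 ⊆ U.1 then (1 : K) else 0)) = 0
          simp_rw [one_mul]
          rw [hsum U]
          exact h0)
    rwa [Fintype.card_finset_len, Nat.choose_one_right] at h
  omega

/-- THE POINT RULE, GENERIC CASE: if `1 + c` is a unit of `K` (and `c + 2 ≤ |α|`) then `rank W_{1,1+c}(α) = |α|`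
(every unit row vector is in the column span: `(1 + c) e_{{x}} = col (B ∪ {x}) − Σ_{z ∈ B} (e_{{z}} − e_{{x}})`). -/
theorem rank_incl_point_of_cast_ne_zero (t c : ℕ) (ht : t = 1) (hc : c + 2 ≤ Fintype.card α) (h0 : ((t + c : ℕ) : K) ≠ 0) :
    (Matrix.of fun (T : {S : Finset α // S.card = t}) (U : {S : Finset α // S.card = t + c}) => if T.1 ⊆ U.1 then (1 : K) else 0).rank =
      Fintype.card α := by
  have hsub := single_sub_single_mem_span_incl_point K t c ht hc
  have hle := rank_incl_le_choose K (α := α) t c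
  subst ht
  rw [Nat.choose_one_right] at hle
  set A := (Matrix.of fun (T : {S : Finset α // S.card = 1}) (U : {S : Finset α // S.card = 1 + c}) =>
    if T.1 ⊆ U.1 then (1 : K) else 0) with hA
  have hone : ∀ s : {S : Finset α // S.card = 1},
      (Pi.single s (1 : K) : {S : Finset α // S.card = 1} → K) ∈ Submodule.span K (Set.range A.col) := by
    intro s
    obtain ⟨x, hx⟩ := Finset.card_eq_one.mp s.2
    have hs : s = ⟨{x}, Finset.card_singleton x⟩ := Subtype.ext hx
    obtain ⟨B, hxB, -, hBc⟩ := exists_notMem_notMem_card_eq x x c hc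
    let U : {S : Finset α // S.card = 1 + c} := ⟨insert x B, by rw [Finset.card_insert_of_notMem hxB, hBc, add_comm]⟩
    -- `col U = e_s + Σ_{z ∈ B} e_{{z}}`
    have hcol : A.col U = Pi.single s (1 : K) +
        ∑ z ∈ B, (Pi.single (⟨{z}, Finset.card_singleton z⟩ : {S : Finset α // S.card = 1}) (1 : K) : {S : Finset α // S.card = 1} → K) := by
      funext T
      rw [Matrix.col_apply, hA, Matrix.of_apply, ite_singleton_subset_insert K x B hxB T, Pi.add_apply, Finset.sum_apply, hs,
        Pi.single_apply]
      congr 1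
      simp_rw [Pi.single_apply]
      obtain ⟨w, hw⟩ := Finset.card_eq_one.mp T.2
      have hT : T = ⟨{w}, Finset.card_singleton w⟩ := Subtype.ext hw
      rw [hT]
      simp only [Subtype.mk.injEq, Finset.singleton_inj, Finset.singleton_subset_iff]
      rw [Finset.sum_ite_eq B w (fun _ => (1 : K))]
    -- `Σ_{z ∈ B} (e_{{z}} − e_s)` lies in the span
    have hmemB : (∑ z ∈ B, ((Pi.single (⟨{z}, Finset.card_singleton z⟩ : {S : Finset α // S.card = 1}) (1 : K) : {S : Finset α // S.card = 1} → K) -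
        Pi.single s (1 : K))) ∈ Submodule.span K (Set.range A.col) :=
      Submodule.sum_mem _ (fun z _ => hsub _ _)
    have hkey : ((1 + c : ℕ) : K) • (Pi.single s (1 : K) : {S : Finset α // S.card = 1} → K) =
        A.col U - ∑ z ∈ B, ((Pi.single (⟨{z}, Finset.card_singleton z⟩ : {S : Finset α // S.card = 1}) (1 : K) : {S : Finset α // S.card = 1} → K) -
          Pi.single s (1 : K)) := by
      rw [hcol, Finset.sum_sub_distrib, Finset.sum_const, hBc, Nat.cast_add, Nat.cast_one, add_smul, one_smul, ← Nat.cast_smul_eq_nsmul K]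
      abel
    have hmem : ((1 + c : ℕ) : K) • (Pi.single s (1 : K) : {S : Finset α // S.card = 1} → K) ∈ Submodule.span K (Set.range A.col) := by
      rw [hkey]
      exact Submodule.sub_mem _ (Submodule.subset_span ⟨U, rfl⟩) hmemB
    have h := Submodule.smul_mem _ (((1 + c : ℕ) : K)⁻¹) hmem
    rwa [smul_smul, inv_mul_cancel₀ h0, one_smul] at h
  have hge : Fintype.card α ≤ A.rank := by
    have h := card_le_rank_add_card_of_single_mem_sup (ι := Empty) A (fun i => (Empty.elim i : {S : Finset α // S.card = 1} → K))
      (fun s => Submodule.mem_sup_left (hone s))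
    rw [Fintype.card_finset_len, Nat.choose_one_right] at h
    simpa only [Fintype.card_eq_zero, add_zero] using h
  omega

end Incl

/-! ## The census matrices at `d = 3`, level `1`: `×q^c : B_{k−1−c} → B_{k−1}` on `B = K[x₁,…,x_k]/(xᵢ²)` -/

section Census

variable (K : Type*) [Field K]

/-- BRIDGE: anchor 229's multiplicity matrix of `×q^c` at `d = 3` (`e = 0`) and level `j = 1`, with the index arithmetic normalised
(`Fin 2`; codegrees `1` and `1 + c` out of `k`; `colR 3`), has the same rank as the literal instance `e = 0, j = 1` of anchor 229 /
230's matrix (reindexing along `Equiv.subtypeEquivRight`). -/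
theorem rank_d3_one_eq (k c : ℕ) :
    (Matrix.of fun (v : {v : Fin k → Fin 2 // (∑ i, (v i : ℕ)) + 1 = k}) (m : {m : Fin k → Fin 2 // (∑ i, (m i : ℕ)) + (1 + c) = k}) =>
      ((((List.flatMap (colR 3))^[c] [List.ofFn (fun i => (m.1 i : ℕ))]).count (List.ofFn (fun i => (v.1 i : ℕ))) : ℕ) : K)).rank =
    (Matrix.of fun (v : {v : Fin k → Fin (0 + 2) // (∑ i, (v i : ℕ)) + 1 = k * (0 + 1)})
        (m : {m : Fin k → Fin (0 + 2) // (∑ i, (m i : ℕ)) + (1 + c * (0 + 1)) = k * (0 + 1)}) =>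
      ((((List.flatMap (colR (0 + 3)))^[c] [List.ofFn (fun i => (m.1 i : ℕ))]).count (List.ofFn (fun i => (v.1 i : ℕ))) : ℕ) : K)).rank := by
  rw [← Matrix.rank_reindex
    (Equiv.subtypeEquivRight (fun (v : Fin k → Fin (0 + 2)) => Iff.intro (fun h => by omega) (fun h => by omega)) :
      {v : Fin k → Fin (0 + 2) // (∑ i, (v i : ℕ)) + 1 = k * (0 + 1)} ≃ {v : Fin k → Fin 2 // (∑ i, (v i : ℕ)) + 1 = k})
    (Equiv.subtypeEquivRight (fun (m : Fin k → Fin (0 + 2)) => Iff.intro (fun h => by omega) (fun h => by omega)) :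
      {m : Fin k → Fin (0 + 2) // (∑ i, (m i : ℕ)) + (1 + c * (0 + 1)) = k * (0 + 1)} ≃ {m : Fin k → Fin 2 // (∑ i, (m i : ℕ)) + (1 + c) = k})]
  rfl

/-- THE UNIQUE LABEL at `e = 0`: every `μ : Fin k → Fin (0 + 1)` is `0`, so anchor 230's label sum has one term, whose condition holds,
with `t = 1` and all `k` points label-zero. -/
theorem label_d3 (k : ℕ) (μ : Fin k → Fin (0 + 1)) :
    (∑ i, (μ i : ℕ)) = 0 ∧ (Finset.univ.filter (fun l => (μ l : ℕ) ≠ 0)) = ∅ ∧ Fintype.card {x : Fin k // (μ x : ℕ) = 0} = k := by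
  refine ⟨Finset.sum_eq_zero (fun i _ => by have := (μ i).2; omega),
    Finset.filter_eq_empty_iff.mpr (fun l _ => by have := (μ l).2; omega), ?_⟩
  rw [Fintype.card_subtype, Finset.filter_true_of_mem (fun l _ => by have := (μ l).2; omega), Finset.card_univ, Fintype.card_fin]

/-- `d = 3`, LEVEL `1`, `c!` A UNIT and `1 + c = 0` IN `K` (`c + 2 ≤ k`): the multiplicity matrix of `×q^c : B_{k−1−c} → B_{k−1}` has rank
`k − 1` — ONE BELOW THEOREM L's characteristic-`0` value `min (C(k,1), C(k,1+c)) = k` (anchor 229). -/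
theorem rank_mulDeltaPow_d3_one_of_cast_eq_zero (k c : ℕ) (hk : c + 2 ≤ k) (hc : ((c.factorial : ℕ) : K) ≠ 0)
    (h0 : ((1 + c : ℕ) : K) = 0) :
    (Matrix.of fun (v : {v : Fin k → Fin 2 // (∑ i, (v i : ℕ)) + 1 = k}) (m : {m : Fin k → Fin 2 // (∑ i, (m i : ℕ)) + (1 + c) = k}) =>
      ((((List.flatMap (colR 3))^[c] [List.ofFn (fun i => (m.1 i : ℕ))]).count (List.ofFn (fun i => (v.1 i : ℕ))) : ℕ) : K)).rank = k - 1 := by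
  rw [rank_d3_one_eq K k c, rank_mulDeltaPow_levels_eq_sum K k 0 c 1,
    Finset.sum_eq_single_of_mem (fun _ => (0 : Fin (0 + 1))) (Finset.mem_univ _)
      (fun μ _ hne => (hne (funext fun i => Fin.ext (by rw [Fin.val_zero]; have := (μ i).2; omega))).elim)]
  beta_reduce
  obtain ⟨hsum, hfilter, hα⟩ := label_d3 k (fun _ => (0 : Fin (0 + 1)))
  have ht : (1 + ∑ i, (((fun _ => (0 : Fin (0 + 1))) : Fin k → Fin (0 + 1)) i : ℕ)) / (0 + 1) -
      (Finset.univ.filter (fun l => (((fun _ => (0 : Fin (0 + 1))) : Fin k → Fin (0 + 1)) l : ℕ) ≠ 0)).card = 1 := by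
    rw [hsum, hfilter, Finset.card_empty]
  have hcond : (0 + 1) ∣ (1 + ∑ i, (((fun _ => (0 : Fin (0 + 1))) : Fin k → Fin (0 + 1)) i : ℕ)) ∧
      (0 + 1) * (Finset.univ.filter (fun l => (((fun _ => (0 : Fin (0 + 1))) : Fin k → Fin (0 + 1)) l : ℕ) ≠ 0)).card ≤
        1 + ∑ i, (((fun _ => (0 : Fin (0 + 1))) : Fin k → Fin (0 + 1)) i : ℕ) := by
    rw [hsum, hfilter, Finset.card_empty]; norm_num
  rw [if_pos hcond, rank_smul_of_ne_zero _ _ hc, rank_incl_point_of_cast_eq_zero K _ c ht (by rw [hα]; exact hk) (by rw [ht]; exact h0), hα]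

/-- `d = 3`, LEVEL `1`, `(1 + c)!` A UNIT OF `K` (`c + 2 ≤ k`): the multiplicity matrix of `×q^c : B_{k−1−c} → B_{k−1}` has rank `k`
= THEOREM L's value (the generic case, now over every field in which `1, …, 1 + c` are units — e.g. every characteristic `p > 1 + c`). -/
theorem rank_mulDeltaPow_d3_one_of_cast_ne_zero (k c : ℕ) (hk : c + 2 ≤ k) (hc : ((c.factorial : ℕ) : K) ≠ 0)
    (h0 : ((1 + c : ℕ) : K) ≠ 0) :
    (Matrix.of fun (v : {v : Fin k → Fin 2 // (∑ i, (v i : ℕ)) + 1 = k}) (m : {m : Fin k → Fin 2 // (∑ i, (m i : ℕ)) + (1 + c) = k}) =>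
      ((((List.flatMap (colR 3))^[c] [List.ofFn (fun i => (m.1 i : ℕ))]).count (List.ofFn (fun i => (v.1 i : ℕ))) : ℕ) : K)).rank = k := by
  rw [rank_d3_one_eq K k c, rank_mulDeltaPow_levels_eq_sum K k 0 c 1,
    Finset.sum_eq_single_of_mem (fun _ => (0 : Fin (0 + 1))) (Finset.mem_univ _)
      (fun μ _ hne => (hne (funext fun i => Fin.ext (by rw [Fin.val_zero]; have := (μ i).2; omega))).elim)]
  beta_reduce
  obtain ⟨hsum, hfilter, hα⟩ := label_d3 k (fun _ => (0 : Fin (0 + 1)))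
  have ht : (1 + ∑ i, (((fun _ => (0 : Fin (0 + 1))) : Fin k → Fin (0 + 1)) i : ℕ)) / (0 + 1) -
      (Finset.univ.filter (fun l => (((fun _ => (0 : Fin (0 + 1))) : Fin k → Fin (0 + 1)) l : ℕ) ≠ 0)).card = 1 := by
    rw [hsum, hfilter, Finset.card_empty]
  have hcond : (0 + 1) ∣ (1 + ∑ i, (((fun _ => (0 : Fin (0 + 1))) : Fin k → Fin (0 + 1)) i : ℕ)) ∧
      (0 + 1) * (Finset.univ.filter (fun l => (((fun _ => (0 : Fin (0 + 1))) : Fin k → Fin (0 + 1)) l : ℕ) ≠ 0)).card ≤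
        1 + ∑ i, (((fun _ => (0 : Fin (0 + 1))) : Fin k → Fin (0 + 1)) i : ℕ) := by
    rw [hsum, hfilter, Finset.card_empty]; norm_num
  rw [if_pos hcond, rank_smul_of_ne_zero _ _ hc, rank_incl_point_of_cast_ne_zero K _ c ht (by rw [hα]; exact hk) (by rw [ht]; exact h0), hα]

/-- THE FIRST EXCEPTION OF EVERY PRIME `p`: over every field of characteristic `p`, for `k ≥ p + 1` variables, the multiplicity matrix of
`×q^{p−1} : B_{k−p} → B_{k−1}` on `B = K[x₁,…,x_k]/(xᵢ²)` (`d = 3`, level `1`, power `c = p − 1`) has rank `k − 1`, one below THEOREM L's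
characteristic-`0` value `min (C(k,1), C(k,p)) = k` (anchor 229): `(p − 1)!` is a unit and `1 + (p − 1) = p = 0` in `K`. At `p = 2` it agrees with
the `e = 0, j = 1` instance of anchor 230's (L2) (value `C(k−1,1)`), at `p = 3` with (N3) of `…UnitColumnRankD3Deficit` (`k ≥ 4`); for `p ≥ 5` it is
new — the cells `(d = 3, k, c = p − 1, j = 1)`, `k ≥ p + 1`, of the positive-characteristic exceptions table, beginning at `k = p + 1` (rank `p`). -/
theorem rank_mulDeltaPow_d3_one_charP (p : ℕ) [CharP K p] (hp : p.Prime) (k : ℕ) (hk : p + 1 ≤ k) :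
    (Matrix.of fun (v : {v : Fin k → Fin 2 // (∑ i, (v i : ℕ)) + 1 = k}) (m : {m : Fin k → Fin 2 // (∑ i, (m i : ℕ)) + (1 + (p - 1)) = k}) =>
      ((((List.flatMap (colR 3))^[p - 1] [List.ofFn (fun i => (m.1 i : ℕ))]).count (List.ofFn (fun i => (v.1 i : ℕ))) : ℕ) : K)).rank =
      k - 1 := by
  have h2 := hp.two_le
  refine rank_mulDeltaPow_d3_one_of_cast_eq_zero K k (p - 1) (by omega) ?_ ?_
  · rw [Ne, CharP.cast_eq_zero_iff K p, hp.dvd_factorial]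
    omega
  · rw [show 1 + (p - 1) = p by omega]
    exact CharP.cast_eq_zero K p

end Census

end Summit.HodgeConjecture.HodgeConjecture.HodgeLocus.Census.UnitColumnRankFirstException
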